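import Literature.AlgebraicGeometry.Modules.SheafHom
import HarnessLib

/-!
# The internal Hom and push-forward along an isomorphism: `ε_* 𝓗om(E, M) ≅ 𝓗om(ε_* E, ε_* M)`

Layer `Literature/AlgebraicGeometry/Modules`; companion of `SheafHom.lean` (the internal Hom
`𝓗om(E, M)`, `U ↦ Hom(E|_U, M|_U)`, with its `appLE` calculus). Everything PROVED, no named facts.

* `overHomMk'` — a morphism `E|_U → M|_U` from sectionwise data (local copy of the tree's `overHomMk`
  of `Modules/CechThetaVanishing.lean`, to keep imports light);
* for ANY morphism of schemes `f : Y₀ ⟶ Y₁`: `pushforwardOverHom f E M : (E|_{f⁻¹U} → M|_{f⁻¹U}) →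
  ((f_*E)|_U → (f_*M)|_U)` (same values on `Γ(f_*E, W) = Γ(E, f⁻¹W)`, `appLE_pushforwardOverHom`;
  additive, compatible with restriction, semilinear over `f♯`) and the comparison morphism of
  `𝒪_{Y₁}`-modules **`sheafHomPushforwardComparison f E M : f_* 𝓗om(E, M) ⟶ 𝓗om(f_* E, f_* M)`**;
* for an ISOMORPHISM `ε : Y₀ ≅ Y₁`: the inverse transport `pullbackOverHom` (values computed through
  `Γ(E, W') = Γ(ε_*E, ε⁻¹⁻¹W')`, `appLE_pullbackOverHom`), the two round trips, hence
  `bijective_pushforwardOverHom`, **`isIso_sheafHomPushforwardComparison`** and the isomorphism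
  **`sheafHomPushforwardIso ε E M : ε_* 𝓗om(E, M) ≅ 𝓗om(ε_* E, ε_* M)`** (`_inv_app_apply`).

Motivation (venture HSemireg, bridge (B1), residual gap (T), step W3(c)): the target of Bloch's pairing
is the alternating part of the iterated internal Hom `multiHom 𝓘 T r = 𝓗om(𝓘, 𝓗om(𝓘, … T …))`
(`HodgeTheory/BlochSemiregularityMapReal.lean`); transporting it along an isomorphism of the ambient
scheme iterates this file's isomorphism (with `Deformation/IdealModulePushforward` for `𝓘` and
`Modules/PushforwardIsoAdjunction` for `T`).

References: R. Hartshorne, *Algebraic Geometry* (1977), II Ex. 1.15 and II.5 p. 109 (the sheaf Hom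
`U ↦ Hom(ℱ|_U, 𝒢|_U)`); the statements are its bookkeeping along direct images (reading; no printed
statement is typed verbatim). [Hartshorne1977]
-/

noncomputable section

-- `TopCat.Presheaf`/`Scheme.Modules` are not reducible (as in Mathlib's `AlgebraicGeometry/Modules/Sheaf.lean`).
set_option backward.isDefEq.respectTransparency false

open CategoryTheory AlgebraicGeometry Opposite TopologicalSpace

universe u

namespace Literature.AlgebraicGeometry.Modules

/-! ### Morphisms `E|_U → M|_U` from sectionwise data (local copy of the tree's `overHomMk`) -/

section OverHomMk

variable {X : Scheme.{u}} {E M : X.Modules} {U : X.Opens}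

/-- A morphism `E|_U → M|_U` from sectionwise data: additive maps `f_k : Γ(E, W) → Γ(M, W)` for all
`k : W ⟶ U`, `𝒪(W)`-linear and natural in `W` (same construction as the tree's `overHomMk` of
`Modules/CechThetaVanishing.lean`, copied to keep this file's imports at `Modules/SheafHom`). [folklore] -/
def overHomMk' (f : ∀ ⦃W : X.Opens⦄, (W ⟶ U) → (Γ(E, W) →+ Γ(M, W)))
    (hsmul : ∀ ⦃W : X.Opens⦄ (k : W ⟶ U) (r : Γ(X, W)) (s : Γ(E, W)), f k (r • s) = r • f k s)
    (hnat : ∀ ⦃W V : X.Opens⦄ (k : W ⟶ U) (k' : V ⟶ U) (l : V ⟶ W) (s : Γ(E, W)),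
      f k' (E.presheaf.map l.op s) = M.presheaf.map l.op (f k s)) :
    E.over U ⟶ M.over U where
  val := PresheafOfModules.homMk
    { app := fun W => AddCommGrpCat.ofHom (f W.unop.hom)
      naturality := fun {W V} g => by
        ext s
        change f V.unop.hom (E.presheaf.map g.unop.left.op s) =
          M.presheaf.map g.unop.left.op (f W.unop.hom s)
        exact hnat _ _ _ s }
    (fun W r s => hsmul W.unop.hom r s)

/-- Values of `overHomMk'`. [cite: Hartshorne1977, II.5 (sheaf Hom U ↦ Hom(E|_U, M|_U), p. 109; reading: bookkeeping along direct images)] -/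
@[simp]
theorem appLE_overHomMk' (f : ∀ ⦃W : X.Opens⦄, (W ⟶ U) → (Γ(E, W) →+ Γ(M, W)))
    (hsmul : ∀ ⦃W : X.Opens⦄ (k : W ⟶ U) (r : Γ(X, W)) (s : Γ(E, W)), f k (r • s) = r • f k s)
    (hnat : ∀ ⦃W V : X.Opens⦄ (k : W ⟶ U) (k' : V ⟶ U) (l : V ⟶ W) (s : Γ(E, W)),
      f k' (E.presheaf.map l.op s) = M.presheaf.map l.op (f k s))
    {W : X.Opens} (k : W ⟶ U) (s : Γ(E, W)) :
    appLE (overHomMk' f hsmul hnat) k s = f k s := rfl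

/-- Restricting a section along an endomorphism of an open (necessarily the identity) does nothing.
[folklore] -/
private theorem presheaf_map_endo_apply (M : X.Modules) {W : X.Opens} (p : W ⟶ W) (s : Γ(M, W)) :
    M.presheaf.map p.op s = s := by
  rw [Subsingleton.elim p (𝟙 W), op_id, CategoryTheory.Functor.map_id]
  rfl

/-- Restricting a function along an endomorphism of an open does nothing. [folklore] -/
private theorem ringCat_presheaf_map_endo_apply {W : X.Opens} (p : W ⟶ W) (r : Γ(X, W)) :
    X.presheaf.map p.op r = r := by
  rw [Subsingleton.elim p (𝟙 W), op_id, CategoryTheory.Functor.map_id]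
  rfl

end OverHomMk

/-! ### Transport of morphisms of restricted modules along `f : Y₀ ⟶ Y₁` -/

section Pushforward

variable {Y₀ Y₁ : Scheme.{u}} (f : Y₀ ⟶ Y₁) (E M : Y₀.Modules)

/-- **Transport of a morphism of restricted modules along `f`**: `φ₀ : E|_{f⁻¹U} → M|_{f⁻¹U}` gives
`(f_*E)|_U → (f_*M)|_U` with values `s ↦ φ₀(s)` on `Γ(f_*E, W) = Γ(E, f⁻¹W)` (`W ≤ U`). [folklore] -/
def pushforwardOverHom {U : Y₁.Opens} (φ₀ : E.over (f ⁻¹ᵁ U) ⟶ M.over (f ⁻¹ᵁ U)) :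
    ((Scheme.Modules.pushforward f).obj E).over U ⟶ ((Scheme.Modules.pushforward f).obj M).over U :=
  overHomMk'
    (fun W k =>
      { toFun := fun s => (appLE φ₀ ((Opens.map f.base).map k) s : Γ(M, f ⁻¹ᵁ W))
        map_zero' := appLE_zero_right φ₀ _
        map_add' := fun s t => appLE_add_right φ₀ _ s t })
    (fun W k r s => by
      change appLE φ₀ ((Opens.map f.base).map k) (f.app W r • (show Γ(E, f ⁻¹ᵁ W) from s)) =
        f.app W r • appLE φ₀ ((Opens.map f.base).map k) s
      exact appLE_smul_right φ₀ _ _ _)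
    (fun W V k k' l s => by
      change appLE φ₀ ((Opens.map f.base).map k') (E.presheaf.map ((Opens.map f.base).map l).op s) =
        M.presheaf.map ((Opens.map f.base).map l).op (appLE φ₀ ((Opens.map f.base).map k) s)
      rw [← appLE_map φ₀ ((Opens.map f.base).map k) ((Opens.map f.base).map l) s]
      exact appLE_congr_hom φ₀ _ _ _)

variable {f E M} in
/-- Values of `pushforwardOverHom`: `s ↦ φ₀(s)`. [cite: Hartshorne1977, II.5 (sheaf Hom U ↦ Hom(E|_U, M|_U), p. 109; reading: bookkeeping along direct images)] -/
@[simp]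
theorem appLE_pushforwardOverHom {U W : Y₁.Opens} (φ₀ : E.over (f ⁻¹ᵁ U) ⟶ M.over (f ⁻¹ᵁ U))
    (k : W ⟶ U) (s : Γ(E, f ⁻¹ᵁ W)) :
    appLE (pushforwardOverHom f E M φ₀) k s = appLE φ₀ ((Opens.map f.base).map k) s := rfl

variable {f E M} in
/-- `pushforwardOverHom` is additive. [cite: Hartshorne1977, II.5 (sheaf Hom U ↦ Hom(E|_U, M|_U), p. 109; reading: bookkeeping along direct images)] -/
theorem pushforwardOverHom_add {U : Y₁.Opens} (φ₀ ψ₀ : E.over (f ⁻¹ᵁ U) ⟶ M.over (f ⁻¹ᵁ U)) :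
    pushforwardOverHom f E M (φ₀ + ψ₀) = pushforwardOverHom f E M φ₀ + pushforwardOverHom f E M ψ₀ :=
  hom_ext_of_appLE fun _ _ _ => rfl

variable {f E M} in
/-- `pushforwardOverHom 0 = 0`. [cite: Hartshorne1977, II.5 (sheaf Hom U ↦ Hom(E|_U, M|_U), p. 109; reading: bookkeeping along direct images)] -/
@[simp]
theorem pushforwardOverHom_zero {U : Y₁.Opens} :
    pushforwardOverHom f E M (0 : E.over (f ⁻¹ᵁ U) ⟶ M.over (f ⁻¹ᵁ U)) = 0 :=
  hom_ext_of_appLE fun _ _ _ => rfl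

variable {f E M} in
/-- `pushforwardOverHom` commutes with restriction. [cite: Hartshorne1977, II.5 (sheaf Hom U ↦ Hom(E|_U, M|_U), p. 109; reading: bookkeeping along direct images)] -/
theorem restrictHom_pushforwardOverHom {U V : Y₁.Opens} (i : V ⟶ U)
    (φ₀ : E.over (f ⁻¹ᵁ U) ⟶ M.over (f ⁻¹ᵁ U)) :
    restrictHom i (pushforwardOverHom f E M φ₀) =
      pushforwardOverHom f E M (restrictHom ((Opens.map f.base).map i) φ₀) :=
  hom_ext_of_appLE fun _ _ _ => rfl

variable {f E M} in
/-- `pushforwardOverHom` is semilinear over `f♯`: `(f♯ a) • φ₀ ↦ a • _`. [cite: Hartshorne1977, II.5 (sheaf Hom U ↦ Hom(E|_U, M|_U), p. 109; reading: bookkeeping along direct images)] -/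
theorem pushforwardOverHom_smul {U : Y₁.Opens} (a : Γ(Y₁, U))
    (φ₀ : E.over (f ⁻¹ᵁ U) ⟶ M.over (f ⁻¹ᵁ U)) :
    pushforwardOverHom f E M (f.app U a • φ₀) = a • pushforwardOverHom f E M φ₀ := by
  refine hom_ext_of_appLE fun W k s => ?_
  rw [appLE_smul, appLE_pushforwardOverHom, appLE_pushforwardOverHom, appLE_smul]
  change Y₀.presheaf.map ((Opens.map f.base).map k).op (f.app U a) • appLE φ₀ _ s =
    f.app W (Y₁.presheaf.map k.op a) • appLE φ₀ _ s
  congr 1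
  exact (ConcreteCategory.congr_hom (f.naturality k.op) a).symm

/-- **The comparison morphism `f_* 𝓗om(E, M) ⟶ 𝓗om(f_* E, f_* M)`** of `𝒪_{Y₁}`-modules: on sections
over `U` it is `pushforwardOverHom` (`Γ(f_* 𝓗om(E, M), U) = Hom(E|_{f⁻¹U}, M|_{f⁻¹U})`).
[cite: Hartshorne1977, II.5 (sheaf Hom, p. 109; reading: its compatibility with direct images)] -/
def sheafHomPushforwardComparison :
    (Scheme.Modules.pushforward f).obj (sheafHom E M) ⟶
      sheafHom ((Scheme.Modules.pushforward f).obj E) ((Scheme.Modules.pushforward f).obj M) where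
  val := PresheafOfModules.homMk
    { app := fun U => AddCommGrpCat.ofHom
        { toFun := fun φ₀ : E.over (f ⁻¹ᵁ U.unop) ⟶ M.over (f ⁻¹ᵁ U.unop) =>
            (pushforwardOverHom f E M φ₀ :
              ((Scheme.Modules.pushforward f).obj E).over U.unop ⟶
                ((Scheme.Modules.pushforward f).obj M).over U.unop)
          map_zero' := pushforwardOverHom_zero
          map_add' := pushforwardOverHom_add }
      naturality := fun {U V} i => by
        refine AddCommGrpCat.ext fun (φ₀ : E.over (f ⁻¹ᵁ U.unop) ⟶ M.over (f ⁻¹ᵁ U.unop)) => ?_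
        exact (restrictHom_pushforwardOverHom i.unop φ₀).symm }
    (fun U (a : Γ(Y₁, U.unop)) (φ₀ : E.over (f ⁻¹ᵁ U.unop) ⟶ M.over (f ⁻¹ᵁ U.unop)) =>
      pushforwardOverHom_smul a φ₀)

variable {f E M} in
/-- Sections of the comparison morphism: `φ₀ ↦ pushforwardOverHom φ₀`. [cite: Hartshorne1977, II.5 (sheaf Hom U ↦ Hom(E|_U, M|_U), p. 109; reading: bookkeeping along direct images)] -/
@[simp]
theorem sheafHomPushforwardComparison_app_apply (U : Y₁.Opens)
    (φ₀ : E.over (f ⁻¹ᵁ U) ⟶ M.over (f ⁻¹ᵁ U)) :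
    (sheafHomPushforwardComparison f E M).app U φ₀ = pushforwardOverHom f E M φ₀ := rfl

end Pushforward

/-! ### Along an isomorphism `ε : Y₀ ≅ Y₁` the comparison is an isomorphism -/

section Iso

variable {Y₀ Y₁ : Scheme.{u}} (ε : Y₀ ≅ Y₁) (E M : Y₀.Modules)

/-- `ε⁻¹(ε⁻¹⁻¹(W')) = W'`. [cite: Hartshorne1977, II.5 (sheaf Hom U ↦ Hom(E|_U, M|_U), p. 109; reading: bookkeeping along direct images)] -/
theorem preimage_hom_preimage_inv (W' : Y₀.Opens) : ε.hom ⁻¹ᵁ (ε.inv ⁻¹ᵁ W') = W' := by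
  rw [← Scheme.Hom.comp_preimage, ε.hom_inv_id, Scheme.Hom.id_preimage]

/-- `ε⁻¹⁻¹(ε⁻¹(W)) = W`. [cite: Hartshorne1977, II.5 (sheaf Hom U ↦ Hom(E|_U, M|_U), p. 109; reading: bookkeeping along direct images)] -/
theorem preimage_inv_preimage_hom (W : Y₁.Opens) : ε.inv ⁻¹ᵁ (ε.hom ⁻¹ᵁ W) = W := by
  rw [← Scheme.Hom.comp_preimage, ε.inv_hom_id, Scheme.Hom.id_preimage]

variable {ε} in
/-- For `W' ≤ ε⁻¹U`, the inclusion `ε⁻¹⁻¹(W') ≤ U`. [folklore] -/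
def invPreimageHom {U : Y₁.Opens} {W' : Y₀.Opens} (k' : W' ⟶ ε.hom ⁻¹ᵁ U) : ε.inv ⁻¹ᵁ W' ⟶ U :=
  (Opens.map ε.inv.base).map k' ≫ eqToHom (preimage_inv_preimage_hom ε U)

/-- `ε♯_{ε⁻¹⁻¹W'}((ε⁻¹)♯_{W'} r) = r|` through `ε⁻¹(ε⁻¹⁻¹(W')) = W'`. [folklore] -/
private theorem app_hom_app_inv (W' : Y₀.Opens) (r : Γ(Y₀, W')) :
    ε.hom.app (ε.inv ⁻¹ᵁ W') (ε.inv.app W' r) =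
      Y₀.presheaf.map (eqToHom (preimage_hom_preimage_inv ε W')).op r := by
  change (ε.inv.app W' ≫ ε.hom.app (ε.inv ⁻¹ᵁ W')) r = _
  rw [← Scheme.Hom.comp_app, Scheme.Hom.congr_app ε.hom_inv_id W', Scheme.Hom.id_app,
    Category.id_comp]

/-- A section of `E` over `W'` as a section of `ε_* E` over `ε⁻¹⁻¹(W')` (restriction along
`ε⁻¹(ε⁻¹⁻¹(W')) = W'`). [folklore] -/
def toPushforwardSection (W' : Y₀.Opens) (s' : Γ(E, W')) :
    Γ((Scheme.Modules.pushforward ε.hom).obj E, ε.inv ⁻¹ᵁ W') :=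
  (E.presheaf.map (eqToHom (preimage_hom_preimage_inv ε W')).op s' : Γ(E, ε.hom ⁻¹ᵁ (ε.inv ⁻¹ᵁ W')))

/-- A section of `ε_* M` over `ε⁻¹⁻¹(W')` as a section of `M` over `W'`. [folklore] -/
def ofPushforwardSection (W' : Y₀.Opens)
    (t : Γ((Scheme.Modules.pushforward ε.hom).obj M, ε.inv ⁻¹ᵁ W')) : Γ(M, W') :=
  M.presheaf.map (eqToHom (preimage_hom_preimage_inv ε W').symm).op
    (show Γ(M, ε.hom ⁻¹ᵁ (ε.inv ⁻¹ᵁ W')) from t)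

/-- `toPushforwardSection` is additive. [folklore] -/
private theorem toPushforwardSection_add (W' : Y₀.Opens) (s t : Γ(E, W')) :
    toPushforwardSection ε E W' (s + t) =
      toPushforwardSection ε E W' s + toPushforwardSection ε E W' t :=
  map_add (E.presheaf.map _).hom s t

/-- `ofPushforwardSection` is additive. [folklore] -/
private theorem ofPushforwardSection_add (W' : Y₀.Opens)
    (t t' : Γ((Scheme.Modules.pushforward ε.hom).obj M, ε.inv ⁻¹ᵁ W')) :
    ofPushforwardSection ε M W' (t + t') =
      ofPushforwardSection ε M W' t + ofPushforwardSection ε M W' t' :=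
  map_add (M.presheaf.map _).hom _ _

/-- `toPushforwardSection 0 = 0`. [folklore] -/
private theorem toPushforwardSection_zero (W' : Y₀.Opens) : toPushforwardSection ε E W' 0 = 0 :=
  map_zero (E.presheaf.map _).hom

/-- `ofPushforwardSection 0 = 0`. [folklore] -/
private theorem ofPushforwardSection_zero (W' : Y₀.Opens) : ofPushforwardSection ε M W' 0 = 0 :=
  map_zero (M.presheaf.map _).hom

/-- `toPushforwardSection (r • s) = (ε⁻¹)♯(r) • toPushforwardSection s` (the `Γ(Y₁, ε⁻¹⁻¹W')`-action on
`Γ(ε_*E, ε⁻¹⁻¹W')`). [folklore] -/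
private theorem toPushforwardSection_smul (W' : Y₀.Opens) (r : Γ(Y₀, W')) (s : Γ(E, W')) :
    toPushforwardSection ε E W' (r • s) = ε.inv.app W' r • toPushforwardSection ε E W' s := by
  change E.presheaf.map _ (r • s) =
    ε.hom.app (ε.inv ⁻¹ᵁ W') (ε.inv.app W' r) •
      (E.presheaf.map _ s : Γ(E, ε.hom ⁻¹ᵁ (ε.inv ⁻¹ᵁ W')))
  rw [Scheme.Modules.map_smul, app_hom_app_inv]

/-- `ofPushforwardSection ((ε⁻¹)♯(r) • t) = r • ofPushforwardSection t`. [folklore] -/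
private theorem ofPushforwardSection_smul (W' : Y₀.Opens) (r : Γ(Y₀, W'))
    (t : Γ((Scheme.Modules.pushforward ε.hom).obj M, ε.inv ⁻¹ᵁ W')) :
    ofPushforwardSection ε M W' (ε.inv.app W' r • t) = r • ofPushforwardSection ε M W' t := by
  change M.presheaf.map _ (ε.hom.app (ε.inv ⁻¹ᵁ W') (ε.inv.app W' r) •
      (show Γ(M, ε.hom ⁻¹ᵁ (ε.inv ⁻¹ᵁ W')) from t)) = r • M.presheaf.map _ _
  rw [app_hom_app_inv, Scheme.Modules.map_smul]
  congr 1
  rw [← CategoryTheory.comp_apply, ← Y₀.presheaf.map_comp, ← op_comp]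
  exact ringCat_presheaf_map_endo_apply _ r

/-- `toPushforwardSection` commutes with restriction. [folklore] -/
private theorem toPushforwardSection_map {W' V' : Y₀.Opens} (l : V' ⟶ W') (s : Γ(E, W')) :
    toPushforwardSection ε E V' (E.presheaf.map l.op s) =
      ((Scheme.Modules.pushforward ε.hom).obj E).presheaf.map ((Opens.map ε.inv.base).map l).op
        (toPushforwardSection ε E W' s) := by
  change E.presheaf.map _ (E.presheaf.map l.op s) =
    E.presheaf.map ((Opens.map ε.hom.base).map ((Opens.map ε.inv.base).map l)).op
      (E.presheaf.map (eqToHom (preimage_hom_preimage_inv ε W')).op s)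
  rw [presheaf_map_map, presheaf_map_map]
  exact congrArg (fun q => E.presheaf.map (Quiver.Hom.op q) s) (Subsingleton.elim _ _)

/-- `ofPushforwardSection` commutes with restriction. [folklore] -/
private theorem ofPushforwardSection_map {W' V' : Y₀.Opens} (l : V' ⟶ W')
    (t : Γ((Scheme.Modules.pushforward ε.hom).obj M, ε.inv ⁻¹ᵁ W')) :
    ofPushforwardSection ε M V'
        (((Scheme.Modules.pushforward ε.hom).obj M).presheaf.map
          ((Opens.map ε.inv.base).map l).op t) =
      M.presheaf.map l.op (ofPushforwardSection ε M W' t) := by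
  change M.presheaf.map (eqToHom (preimage_hom_preimage_inv ε V').symm).op
      (M.presheaf.map ((Opens.map ε.hom.base).map ((Opens.map ε.inv.base).map l)).op
        (show Γ(M, ε.hom ⁻¹ᵁ (ε.inv ⁻¹ᵁ W')) from t)) =
    M.presheaf.map l.op (M.presheaf.map (eqToHom (preimage_hom_preimage_inv ε W').symm).op
      (show Γ(M, ε.hom ⁻¹ᵁ (ε.inv ⁻¹ᵁ W')) from t))
  rw [presheaf_map_map, presheaf_map_map]
  exact congrArg (fun q => M.presheaf.map (Quiver.Hom.op q) _) (Subsingleton.elim _ _)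

/-- The round trip on a section of `ε_* M` over `W`, read over `ε⁻¹⁻¹(ε⁻¹(W)) = W`. [folklore] -/
private theorem ofPushforwardSection_map_eqToHom (W : Y₁.Opens)
    (y : Γ((Scheme.Modules.pushforward ε.hom).obj M, W)) :
    ofPushforwardSection ε M (ε.hom ⁻¹ᵁ W)
        (((Scheme.Modules.pushforward ε.hom).obj M).presheaf.map
          (eqToHom (preimage_inv_preimage_hom ε W)).op y) = y := by
  change M.presheaf.map (eqToHom (preimage_hom_preimage_inv ε (ε.hom ⁻¹ᵁ W)).symm).op
      (M.presheaf.map ((Opens.map ε.hom.base).map (eqToHom (preimage_inv_preimage_hom ε W))).op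
        (show Γ(M, ε.hom ⁻¹ᵁ W) from y)) = (show Γ(M, ε.hom ⁻¹ᵁ W) from y)
  rw [presheaf_map_map]
  exact presheaf_map_endo_apply M _ _

/-- The round trip `ofPushforwardSection (M.map (eqToHom) y) = y` for `y ∈ Γ(M, W')`. [folklore] -/
private theorem ofPushforwardSection_map_eqToHom' (W' : Y₀.Opens) (y : Γ(M, W')) :
    ofPushforwardSection ε M W'
        (show Γ((Scheme.Modules.pushforward ε.hom).obj M, ε.inv ⁻¹ᵁ W') from
          (M.presheaf.map (eqToHom (preimage_hom_preimage_inv ε W')).op y :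
            Γ(M, ε.hom ⁻¹ᵁ (ε.inv ⁻¹ᵁ W')))) = y := by
  change M.presheaf.map _ (M.presheaf.map _ _) = _
  rw [presheaf_map_map]
  exact presheaf_map_endo_apply M _ _

/-- A section of `ε_* E` over `W`, restricted to `ε⁻¹⁻¹(ε⁻¹(W))`, is `toPushforwardSection` of itself
read over `ε⁻¹W`. [folklore] -/
private theorem toPushforwardSection_eq (W : Y₁.Opens)
    (s : Γ((Scheme.Modules.pushforward ε.hom).obj E, W)) :
    toPushforwardSection ε E (ε.hom ⁻¹ᵁ W) s =
      ((Scheme.Modules.pushforward ε.hom).obj E).presheaf.map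
        (eqToHom (preimage_inv_preimage_hom ε W)).op s := by
  change E.presheaf.map _ _ = E.presheaf.map _ _
  exact congrArg (fun q => E.presheaf.map (Quiver.Hom.op q) _) (Subsingleton.elim _ _)

/-- **Inverse transport**: `ψ : (ε_*E)|_U → (ε_*M)|_U` gives `E|_{ε⁻¹U} → M|_{ε⁻¹U}`, with values at
`s' ∈ Γ(E, W')` (`W' ≤ ε⁻¹U`) computed through `Γ(E, W') = Γ(ε_*E, ε⁻¹⁻¹W')`. [folklore] -/
def pullbackOverHom {U : Y₁.Opens}
    (ψ : ((Scheme.Modules.pushforward ε.hom).obj E).over U ⟶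
      ((Scheme.Modules.pushforward ε.hom).obj M).over U) :
    E.over (ε.hom ⁻¹ᵁ U) ⟶ M.over (ε.hom ⁻¹ᵁ U) :=
  overHomMk'
    (fun W' k' =>
      { toFun := fun s' =>
          ofPushforwardSection ε M W' (appLE ψ (invPreimageHom k') (toPushforwardSection ε E W' s'))
        map_zero' := by
          rw [toPushforwardSection_zero, appLE_zero_right, ofPushforwardSection_zero]
        map_add' := fun s t => by
          rw [toPushforwardSection_add, appLE_add_right, ofPushforwardSection_add] })
    (fun W' k' r s' => by
      change ofPushforwardSection ε M W' (appLE ψ _ (toPushforwardSection ε E W' (r • s'))) =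
        r • ofPushforwardSection ε M W' (appLE ψ _ (toPushforwardSection ε E W' s'))
      rw [toPushforwardSection_smul, appLE_smul_right, ofPushforwardSection_smul])
    (fun W' V' k' k'' l s' => by
      change ofPushforwardSection ε M V'
          (appLE ψ _ (toPushforwardSection ε E V' (E.presheaf.map l.op s'))) =
        M.presheaf.map l.op
          (ofPushforwardSection ε M W' (appLE ψ _ (toPushforwardSection ε E W' s')))
      rw [toPushforwardSection_map, ← ofPushforwardSection_map,
        show invPreimageHom k'' = (Opens.map ε.inv.base).map l ≫ invPreimageHom k' from
          Subsingleton.elim _ _, appLE_map])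

variable {ε E M} in
/-- Values of `pullbackOverHom`. [cite: Hartshorne1977, II.5 (sheaf Hom U ↦ Hom(E|_U, M|_U), p. 109; reading: bookkeeping along direct images)] -/
theorem appLE_pullbackOverHom {U : Y₁.Opens}
    (ψ : ((Scheme.Modules.pushforward ε.hom).obj E).over U ⟶
      ((Scheme.Modules.pushforward ε.hom).obj M).over U)
    {W' : Y₀.Opens} (k' : W' ⟶ ε.hom ⁻¹ᵁ U) (s' : Γ(E, W')) :
    appLE (pullbackOverHom ε E M ψ) k' s' =
      ofPushforwardSection ε M W'
        (appLE ψ (invPreimageHom k') (toPushforwardSection ε E W' s')) :=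
  rfl

/-- `pushforwardOverHom ∘ pullbackOverHom = id`. [cite: Hartshorne1977, II.5 (sheaf Hom U ↦ Hom(E|_U, M|_U), p. 109; reading: bookkeeping along direct images)] -/
theorem pushforwardOverHom_pullbackOverHom {U : Y₁.Opens}
    (ψ : ((Scheme.Modules.pushforward ε.hom).obj E).over U ⟶
      ((Scheme.Modules.pushforward ε.hom).obj M).over U) :
    pushforwardOverHom ε.hom E M (pullbackOverHom ε E M ψ) = ψ := by
  refine hom_ext_of_appLE fun W k s => ?_
  rw [appLE_pushforwardOverHom, appLE_pullbackOverHom, toPushforwardSection_eq,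
    show invPreimageHom ((Opens.map ε.hom.base).map k) =
      eqToHom (preimage_inv_preimage_hom ε W) ≫ k from Subsingleton.elim _ _, appLE_map ψ k]
  exact ofPushforwardSection_map_eqToHom ε M W _

/-- `pullbackOverHom ∘ pushforwardOverHom = id`. [cite: Hartshorne1977, II.5 (sheaf Hom U ↦ Hom(E|_U, M|_U), p. 109; reading: bookkeeping along direct images)] -/
theorem pullbackOverHom_pushforwardOverHom {U : Y₁.Opens}
    (φ₀ : E.over (ε.hom ⁻¹ᵁ U) ⟶ M.over (ε.hom ⁻¹ᵁ U)) :
    pullbackOverHom ε E M (pushforwardOverHom ε.hom E M φ₀) = φ₀ := by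
  refine hom_ext_of_appLE fun W' k' s' => ?_
  rw [appLE_pullbackOverHom, appLE_pushforwardOverHom,
    show (Opens.map ε.hom.base).map (invPreimageHom k') =
      eqToHom (preimage_hom_preimage_inv ε W') ≫ k' from Subsingleton.elim _ _]
  erw [appLE_map φ₀ k' (eqToHom (preimage_hom_preimage_inv ε W')) s']
  exact ofPushforwardSection_map_eqToHom' ε M W' _

/-- **The transport `pushforwardOverHom ε.hom` is a bijection** on morphisms of restricted modules
for an isomorphism `ε`. [cite: Hartshorne1977, II.5 (sheaf Hom U ↦ Hom(E|_U, M|_U), p. 109; reading: bookkeeping along direct images)] -/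
theorem bijective_pushforwardOverHom (U : Y₁.Opens) :
    Function.Bijective (pushforwardOverHom ε.hom E M (U := U)) :=
  Function.bijective_iff_has_inverse.mpr ⟨pullbackOverHom ε E M,
    pullbackOverHom_pushforwardOverHom ε E M, pushforwardOverHom_pullbackOverHom ε E M⟩

/-- **`ε_* 𝓗om(E, M) ⟶ 𝓗om(ε_* E, ε_* M)` is an isomorphism** for an isomorphism of schemes `ε`.
[cite: Hartshorne1977, II.5 (sheaf Hom, p. 109; reading: its compatibility with direct images along an isomorphism)] -/
instance isIso_sheafHomPushforwardComparison :
    IsIso (sheafHomPushforwardComparison ε.hom E M) := by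
  refine Scheme.Modules.Hom.isIso_iff_isIso_app.mpr fun U => ?_
  rw [ConcreteCategory.isIso_iff_bijective]
  exact bijective_pushforwardOverHom ε E M U

/-- **`ε_* 𝓗om(E, M) ≅ 𝓗om(ε_* E, ε_* M)`** for an isomorphism of schemes `ε : Y₀ ≅ Y₁`; on sections
over `U` the isomorphism sends `φ₀ : E|_{ε⁻¹U} → M|_{ε⁻¹U}` to the morphism with the same values on
`Γ(ε_*E, W) = Γ(E, ε⁻¹W)` (`appLE_pushforwardOverHom`).
[cite: Hartshorne1977, II.5 (sheaf Hom, p. 109; reading: its compatibility with direct images along an isomorphism)] -/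
def sheafHomPushforwardIso :
    (Scheme.Modules.pushforward ε.hom).obj (sheafHom E M) ≅
      sheafHom ((Scheme.Modules.pushforward ε.hom).obj E)
        ((Scheme.Modules.pushforward ε.hom).obj M) :=
  asIso (sheafHomPushforwardComparison ε.hom E M)

/-- `(sheafHomPushforwardIso ε E M).hom = sheafHomPushforwardComparison ε.hom E M`.
[cite: Hartshorne1977, II.5 (sheaf Hom, p. 109; reading: its compatibility with direct images along an isomorphism)] -/
@[simp]
theorem sheafHomPushforwardIso_hom :
    (sheafHomPushforwardIso ε E M).hom = sheafHomPushforwardComparison ε.hom E M := rfl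

/-- Sections of the inverse: `ψ ↦ pullbackOverHom ψ`.
[cite: Hartshorne1977, II.5 (sheaf Hom, p. 109; reading: its compatibility with direct images along an isomorphism)] -/
theorem sheafHomPushforwardIso_inv_app_apply (U : Y₁.Opens)
    (ψ : ((Scheme.Modules.pushforward ε.hom).obj E).over U ⟶
      ((Scheme.Modules.pushforward ε.hom).obj M).over U) :
    (sheafHomPushforwardIso ε E M).inv.app U ψ = pullbackOverHom ε E M ψ := by
  apply (bijective_pushforwardOverHom ε E M U).1
  change ((sheafHomPushforwardIso ε E M).inv ≫ (sheafHomPushforwardIso ε E M).hom).app U ψ =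
    pushforwardOverHom ε.hom E M (pullbackOverHom ε E M ψ)
  rw [Iso.inv_hom_id, Scheme.Modules.Hom.id_app, pushforwardOverHom_pullbackOverHom]
  rfl

end Iso


end Literature.AlgebraicGeometry.Modules

end
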